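import Summits.QuantumFields.YangMills.Theorems.LangevinControlUVFemtoCurvatureSkewnessCRatioTransportDefsF

/-!
# Route `LangevinControlUV`, crux `FemtoCurvatureSkewnessC` (stmt-QuantumFields-16205), line `ratio-transport`: vocabulary (G) —
# the line's target as ONE statement (`RatioFloorC`, skeleton v5's single stub) and the dominating engine form (`PressureDominanceC`)

Lead `prover-line-stmt-QuantumFields-16205-c3-0` (line lead, cycle 4, 2026-08-16), companion (G) of the route-posited vocabulary files
`…CRatioTransportDefs.lean` (p121740), `…DefsB.lean` (p123565), `…DefsC.lean` (p125065), `…DefsD.lean` (p126481), `…DefsE.lean` (p127471),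
`…DefsF.lean` (p128642).  Route-posited `def … : Prop`s only; NOTHING is asserted; none is a literature fact; none restates the crux
(the crux allows ANY positive shape `Γ₃` below `n¹²|κ₃|`; `RatioFloorC` pins the tree shape `Γ^{3/2}` — a genuine strengthening, the
"tree-level truth" `u → 2^{3/2} d^{-1/2}`).

## Why (the reshape v4.2 → v5 and the dominance finding of cycle 4)

Skeleton v4.2 closes the crux modulo FOUR stubs — E_c `CutoffEngineTE` (two-ended cutoff transport along `M`-adic RG chains: a CAUCHY /
convergence statement), E_v `VolumeEngineQ` and E_s `SeparationEngineQ` (moduli of continuity of the femto values in `log L`, `log n`),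
A `Anchors` (fixed-torus `β → ∞` asymptotics WITH VALUE, torons included) — all certified `stub-blocked` by three waves (no fact behind
any).  Reading the landed descent once more: the four stubs are consumed ONLY to produce `RatioFloor r a₀` at the hypothesis map
(`ratioFloor_of_twoEndedQ`, p128513), after which the line's landed back half (`signedRigidity_of_ratioFloor` p123064 →
`skewnessPackage_of_signedRigidity` → `femtoCurvatureSkewnessC_iff`) closes the crux with output map `a₀`.  So:

* `RatioFloorC` — the floor at every continuous package map — is the line's target as ONE statement; skeleton v5 registers it as the single
  stub `stub_ratioFloorC` (monotone reshape: `ratioFloorC_of_enginesQ : CutoffEngineTE → VolumeEngineQ → SeparationEngineQ → Anchors →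
  RatioFloorC`, companion bridges file).
* `PressureDominanceC` — one-loop (tree) dominance of the marked-coupling pressure derivatives `−D₃`, `D₂` with ONE coupling factor and a
  FIXED relative error `θ < 1` on the femto boxes of SOME continuous package map (the sibling line `coupling-cubic-response`'s engine stub
  `MarkedCouplingDominance` in C-form: continuous hypothesis, continuous output, honesty dropped) — gives `RatioFloorC` DIRECTLY
  (`ratioFloorC_of_pressureDominanceC`: `PressureCGF` + the pointwise cancellation of `λ`, `G_a`, `G_d` in the ratio + the landed ruler
  rigidity to move the floor to `a₀`'s boxes) and the crux even more directly (`femtoCurvatureSkewnessC_of_pressureDominanceC`, via the landed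
  `signedRigidity_of_dominance`).  No transport, no anchors, no continuum limit, no toron semiclassics.  It is what an asymptotic-freedom
  engine outputs FIRST (remainder `O(g²(s))·tree` inside `θ` for `s ≤ ℓ₁` small), whereas v4.2's E_c asks for convergence along RG chains
  (isolating the cutoff dependence of the remainder, not just bounding it) and A asks for a separate finite-dimensional Laplace analysis
  through the toron strata.  Hence the lead's revised promotion recommendation: ONE physics item, `PressureDominanceC` (engine form) — or
  `RatioFloorC` (corollary form, the registered stub) — instead of (P) `RatioTransportEngineQ`/`ProfileEngine` + (A) `AnchorsTreeDominance`.
-/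

set_option autoImplicit false

noncomputable section

namespace Summit.QuantumFields.YangMills.Cruxes.FemtoCurvatureSkewnessC.RatioTransport

open MeasureTheory Filter Topology
open Literature.MathematicalPhysics.QuantumFieldTheory
open Summit.QuantumFields.YangMills.Theorems.FemtoCurvatureSkewness.Negative (TwoPointPackage)
open Summit.QuantumFields.YangMills.Cruxes.FemtoCurvatureSkewness.CouplingCubicResponse (PressureDominance)

/-- **The line's target as ONE statement over the hypothesis data** (skeleton v5's single stub): for compact simple `G`, any `r`
and any CONTINUOUS map `a₀` carrying the two-point package, the tree-normalised skewness ratio `u = κ₃·G_a/(Cov^{3/2}·G_d)` has a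
positive floor on the femto boxes of `a₀` (`RatioFloor r a₀`).  Implied by the four v4.2 stubs (`ratioFloorC_of_enginesQ`) and by
`PressureDominanceC` (`ratioFloorC_of_pressureDominanceC`); closes the crux through the landed back half of the line
(`femtoCurvatureSkewnessC_of_ratioFloorC`).  NOT asserted. -/
def RatioFloorC : Prop :=
  ∀ (G : Type) [Group G] [TopologicalSpace G] [IsTopologicalGroup G] [CompactSpace G]
    [MeasurableSpace G] [BorelSpace G], IsCompactSimpleLieGroup G →
    ∀ (r : LatticeRep G) (a₀ : ℝ → ℝ), Continuous a₀ → TwoPointPackage r a₀ → RatioFloor r a₀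

/-- **Pressure dominance in C-form** (the sibling line `coupling-cubic-response`'s engine statement `MarkedCouplingDominance`, weakened
to exactly what the C-crux consumes: continuous-hypothesis, continuous-output, no honesty): for compact simple `G` and any `r`, if some
continuous unit map carries the two-point package then some continuous unit map carries the package together with one-loop dominance of
the marked-coupling pressure derivatives on its femto boxes (`PressureDominance`, fixed relative error).  NOT asserted. -/
def PressureDominanceC : Prop :=
  ∀ (G : Type) [Group G] [TopologicalSpace G] [IsTopologicalGroup G] [CompactSpace G]
    [MeasurableSpace G] [BorelSpace G], IsCompactSimpleLieGroup G →
    ∀ (r : LatticeRep G), (∃ a : ℝ → ℝ, Continuous a ∧ TwoPointPackage r a) →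
      ∃ a : ℝ → ℝ, Continuous a ∧ TwoPointPackage r a ∧ PressureDominance r a

/-- Registered signature of the single stub of skeleton v5. -/
def Sig.stub_ratioFloorC : Prop := RatioFloorC

end Summit.QuantumFields.YangMills.Cruxes.FemtoCurvatureSkewnessC.RatioTransport

end
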